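import Literature.NumberTheory.LFunctions.FordVinogradovBridge
import Literature.NumberTheory.LFunctions.FordFejerKernel
import Literature.NumberTheory.LFunctions.FordVinogradovZRD
import HarnessLib

/-!
# Ford's Lemma 5.1, core: the bilinear bound (5.3) with the smoothing (5.4)–(5.5)

Topic `Literature/NumberTheory/LFunctions`.  Everything in this file is PROVED; no named fact is
introduced (the `def`s `thetaB`, `unitOf`, `Wt`, `Fk` are data).

K. Ford, *Vinogradov's integral and bounds for the Riemann zeta function*, Proc. LMS 85 (2002),
proof of Lemma 5.1: for `U = ∑_{b ∈ ℬ} ∑_{a ≤ M} e(γ₁ ab + ⋯ + γ_k (ab)^k)` one has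

  `|U|^{2rs} ≤ |ℬ|^{2rs-2s} M^{2rs-2r} J_{r,k}(M) T`,  `T = ∑_𝐜 |∑_{b∈ℬ} ε_b e(γ₁bc₁ + ⋯ + γ_k b^k c_k)|^{2s}` (5.3)

(Hölder twice, `n(𝐜) = #{𝐚 ∈ [1,M]^r : s(𝐚) = 𝐜}`, `∑ n(𝐜) = M^r`, `∑ n(𝐜)² = J_{r,k}(M)`), and, by
inserting the weights `f_j(c_j) ≥ 1` (`FordFejerKernel.lean`) and expanding `|·|^{2s}`,

  `T ≤ (5r)^k M^{k(k+1)/2} #{(𝐱,𝐲) ∈ ℬ^{2s} : ‖γ_j d_j‖ < 1/(2rM^j) ∀ j}`  (5.4)–(5.5)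
  `  ≤ (5r)^k M^{k(k+1)/2} J_{s,k,[h,g]}(ℬ) ∏_{j=h}^{g} |𝒟_j|`,

`d_j = ∑_i (x_i^j - y_i^j)`, `𝒟_j = {|d| ≤ s(P₂^j - 1) : ‖γ_j d‖ < 1/(2rM^j)}` (Proposition ZRD,
`FordVinogradovZRD.lean`).

* `FordVK.fejer_insertion` — the smoothing step in abstract form: for `|ε_b| ≤ 1` and integer vectors
  `𝐜 ∈ C₀` with `1 ≤ c_j ≤ R_j`,
  `∑_{𝐜 ∈ C₀} |∑_b ε_b e(𝐜·θ_b)|^{2s} ≤ (∏_j 5R_j) #{(β,β') : ‖(∑_i θ_{β_i} - ∑_i θ_{β'_i})_j‖ < 1/(2R_j) ∀ j}`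
  (finite boxes `[-L, L]^k`, the identity `∑_{𝐜} ∏_j f_j(c_j) e(𝐜·α) = ∏_j P_{j,L}(α_j)`, and the limit
  `L → ∞` through `FordVK.hasSum_fejerWeight`);
* `FordVK.norm_U_pow_le` — the displayed bound for `|U|^{2rs}` (with `M^{2rs-2r} = (M^r)^{2s-2}`).

## References

* K. Ford, *Vinogradov's integral and bounds for the Riemann zeta function*, Proc. London Math.
  Soc. (3) 85 (2002), 565–633; arXiv:1910.08209. Proof of Lemma 5.1, (5.3)–(5.5). [Ford2002]
-/

noncomputable section

open Finset Real Complex Filter Topology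
open scoped ComplexConjugate

namespace Literature.NumberTheory.LFunctions
namespace FordVK

open VdC VMV

/-! ### Characters in the second argument -/

/-- `E v (α + α') = E v α · E v α'`. [folklore] -/
theorem E_add_right {n : ℕ} (v : Fin n → ℤ) (α α' : Fin n → ℝ) :
    E v (α + α') = E v α * E v α' := by
  unfold E
  rw [← Finset.prod_mul_distrib]
  refine Finset.prod_congr rfl fun j _ => ?_
  rw [Pi.add_apply, mul_add, e_add]

/-- `E v (∑_i α_i) = ∏_i E v α_i`. [folklore] -/
theorem E_sum_right {n : ℕ} (v : Fin n → ℤ) {ι : Type*} (s : Finset ι) (α : ι → Fin n → ℝ) :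
    E v (∑ i ∈ s, α i) = ∏ i ∈ s, E v (α i) := by
  classical
  induction s using Finset.induction_on with
  | empty => simp [E_zero_right]
  | insert a s ha ih => rw [Finset.sum_insert ha, Finset.prod_insert ha, E_add_right, ih]
where
  /-- `E v 0 = 1`. [folklore] -/
  E_zero_right {n : ℕ} (v : Fin n → ℤ) : E v (0 : Fin n → ℝ) = 1 := by
    unfold E; simp [e_zero]

/-- `conj (E v α) = E v (-α)`. [folklore] -/
theorem conj_E_right {n : ℕ} (v : Fin n → ℤ) (α : Fin n → ℝ) : conj (E v α) = E v (-α) := by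
  unfold E
  rw [map_prod]
  refine Finset.prod_congr rfl fun j _ => ?_
  rw [Pi.neg_apply, mul_neg, e_neg]

/-- `E v (α - α') = E v α · conj (E v α')`. [folklore] -/
theorem E_sub_right {n : ℕ} (v : Fin n → ℤ) (α α' : Fin n → ℝ) :
    E v (α - α') = E v α * conj (E v α') := by
  rw [sub_eq_add_neg, E_add_right, conj_E_right]

/-! ### (E1) `V^r` through representation numbers -/

/-- `(∑_{x ∈ I} e(α·ν(x)))^r = ∑_{c} n(c) e(α·c)` with `n(c) = #{a ∈ I^r : s(a) = c}`.
[cite: Ford2002, proof of Lemma 5.1 (definition of `n(𝐜)`)] -/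
theorem tp_pow_eq_sum_rep (k r : ℕ) (I : Finset ℤ) (θ : Fin k → ℝ) :
    (tp I (nu k) θ) ^ r = ∑ c ∈ (tuples r I).image (psv k), (rep k r I c : ℂ) * E c θ := by
  classical
  rw [← tp_tuples_psv]
  unfold tp
  rw [Finset.sum_comp (s := tuples r I) (f := fun c => E c θ) (g := psv k)]
  refine Finset.sum_congr rfl fun c _ => ?_
  rw [nsmul_eq_mul]
  unfold rep
  rfl

/-- `∑_c n(c) = |I|^r`. [folklore] -/
theorem sum_rep_eq (k r : ℕ) (I : Finset ℤ) :
    ∑ c ∈ (tuples r I).image (psv k), rep k r I c = I.card ^ r := by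
  classical
  unfold rep
  rw [← card_eq_sum_card_fiberwise (f := psv k) (s := tuples r I) (t := (tuples r I).image (psv k))
    (fun x hx => mem_image_of_mem _ hx), card_tuples]

/-- `∑_c n(c)² = J_{r,k}(I)`. [cite: Ford2002, (5.3)] -/
theorem sum_rep_sq_eq (k r : ℕ) (I : Finset ℤ) :
    ∑ c ∈ (tuples r I).image (psv k), rep k r I c ^ 2 = J k r I := by
  unfold J
  rw [Jc_eq_sum_rep_mul]
  refine Finset.sum_congr rfl fun c _ => ?_
  rw [add_zero, sq]

/-! ### (E2) the `2s`-th power of `X(c) = ∑_b ε_b e(c·θ_b)` -/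

section Xpow

variable {ι : Type*} {k : ℕ}

/-- `X(c)^s` expanded over `s`-tuples. [folklore] -/
theorem sum_mul_E_pow (B : Finset ι) (ε : ι → ℂ) (θ : ι → Fin k → ℝ) (c : Fin k → ℤ) (s : ℕ) :
    (∑ b ∈ B, ε b * E c (θ b)) ^ s
      = ∑ β ∈ Fintype.piFinset (fun _ : Fin s => B), (∏ i, ε (β i)) * E c (∑ i, θ (β i)) := by
  have hpow : (∑ b ∈ B, ε b * E c (θ b)) ^ s = ∏ _i : Fin s, ∑ b ∈ B, ε b * E c (θ b) := by
    rw [Finset.prod_const, Finset.card_univ, Fintype.card_fin]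
  rw [hpow, Finset.prod_univ_sum (fun _ : Fin s => B) (fun _ b => ε b * E c (θ b))]
  refine Finset.sum_congr rfl fun β _ => ?_
  rw [Finset.prod_mul_distrib, E_sum_right]

/-- `|X(c)|^{2s}` expanded over pairs of `s`-tuples: the differences `∑_i θ_{β_i} - ∑_i θ_{β'_i}`
appear. [cite: Ford2002, proof of Lemma 5.1 (the `d_j`)] -/
theorem norm_sum_mul_E_pow (B : Finset ι) (ε : ι → ℂ) (θ : ι → Fin k → ℝ) (c : Fin k → ℤ)
    (s : ℕ) :
    ((‖∑ b ∈ B, ε b * E c (θ b)‖ ^ (2 * s) : ℝ) : ℂ)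
      = ∑ ββ' ∈ Fintype.piFinset (fun _ : Fin s => B) ×ˢ Fintype.piFinset (fun _ : Fin s => B),
          ((∏ i, ε (ββ'.1 i)) * conj (∏ i, ε (ββ'.2 i)))
            * E c (∑ i, θ (ββ'.1 i) - ∑ i, θ (ββ'.2 i)) := by
  set X := ∑ b ∈ B, ε b * E c (θ b) with hX
  have h1 : ((‖X‖ ^ (2 * s) : ℝ) : ℂ) = X ^ s * conj (X ^ s) := by
    rw [Complex.mul_conj', norm_pow]; push_cast; ring
  rw [h1, hX, sum_mul_E_pow, map_sum, Finset.sum_mul_sum, Finset.sum_product]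
  refine Finset.sum_congr rfl fun β _ => Finset.sum_congr rfl fun β' _ => ?_
  rw [map_mul, E_sub_right]
  ring

end Xpow


/-! ### (E3) Fejér insertion: `T ≤ (∏_j 5R_j) · #{(β,β') : ‖Δθ_j‖ < 1/(2R_j) ∀ j}` -/

section Fejer

variable {ι : Type*} {k : ℕ}

/-- Symmetric partial sums over `[-L, L]` exhaust `ℤ`. [folklore] -/
theorem tendsto_Icc_neg_atTop : Tendsto (fun L : ℕ => Finset.Icc (-(L : ℤ)) (L : ℤ)) atTop atTop := by
  refine tendsto_atTop_finset_of_monotone (fun L L' h => Finset.Icc_subset_Icc (by omega) (by omega))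
    fun x => ⟨x.natAbs, ?_⟩
  rw [Finset.mem_Icc]; omega

/-- The partial sums `P_{j,L}(x) = ∑_{|c| ≤ L} f_{R}(c) e(cx)` converge to `(π² R/2) ℓ(x; 1/(2R))`.
[cite: Ford2002, proof of Lemma 5.1] -/
theorem tendsto_partial_fejer {R : ℝ} (hR : 1 ≤ R) (x : ℝ) :
    Tendsto (fun L : ℕ => ∑ c ∈ Finset.Icc (-(L : ℤ)) (L : ℤ), (fejerWeight R c : ℂ) * e (c * x)) atTop
      (𝓝 (((π ^ 2 * R / 2 * tri (1 / (2 * R)) x : ℝ) : ℂ))) :=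
  (hasSum_fejerWeight hR x).comp tendsto_Icc_neg_atTop

/-- The weight `W(c) = ∏_j f_{R_j}(c_j)`. [cite: Ford2002, proof of Lemma 5.1] -/
def Wt (R : Fin k → ℝ) (c : Fin k → ℤ) : ℝ := ∏ j, fejerWeight (R j) (c j)

/-- `W ≥ 0`. [folklore] -/
theorem Wt_nonneg (R : Fin k → ℝ) (c : Fin k → ℤ) : 0 ≤ Wt R c :=
  Finset.prod_nonneg fun _ _ => fejerWeight_nonneg _ _

/-- `W(c) ≥ 1` when `1 ≤ c_j ≤ R_j` for all `j`. [cite: Ford2002, proof of Lemma 5.1] -/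
theorem one_le_Wt (R : Fin k → ℝ) {c : Fin k → ℤ} (hc : ∀ j, 1 ≤ c j ∧ (c j : ℝ) ≤ R j) : 1 ≤ Wt R c := by
  unfold Wt
  calc (1 : ℝ) = ∏ _j : Fin k, (1 : ℝ) := by simp
    _ ≤ ∏ j, fejerWeight (R j) (c j) :=
        Finset.prod_le_prod (fun _ _ => zero_le_one) fun j _ => one_le_fejerWeight (hc j).1 (hc j).2

/-- The box identity: `∑_{c ∈ [-L,L]^k} W(c) e(c·α) = ∏_j P_{j,L}(α_j)`. [folklore] -/
theorem sum_box_Wt_mul_E (R : Fin k → ℝ) (L : ℕ) (α : Fin k → ℝ) :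
    ∑ c ∈ Fintype.piFinset (fun _ : Fin k => Finset.Icc (-(L : ℤ)) (L : ℤ)), (Wt R c : ℂ) * E c α
      = ∏ j, ∑ cj ∈ Finset.Icc (-(L : ℤ)) (L : ℤ), (fejerWeight (R j) cj : ℂ) * e (cj * α j) := by
  rw [Finset.prod_univ_sum]
  refine Finset.sum_congr rfl fun c _ => ?_
  unfold Wt E
  push_cast
  rw [← Finset.prod_mul_distrib]

/-- The limit kernel `F_j(x) = (π² R_j/2) ℓ(x; 1/(2R_j))`. [cite: Ford2002, proof of Lemma 5.1] -/
def Fk (R : Fin k → ℝ) (j : Fin k) (x : ℝ) : ℝ := π ^ 2 * R j / 2 * tri (1 / (2 * R j)) x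

/-- `∏_j F_j(x_j) ≤ (∏_j 5R_j) · 𝟙[‖x_j‖ < 1/(2R_j) ∀ j]`. [cite: Ford2002, (5.4)] -/
theorem prod_Fk_le (R : Fin k → ℝ) (hR : ∀ j, 1 ≤ R j) (x : Fin k → ℝ) :
    ∏ j, Fk R j (x j)
      ≤ (∏ j, 5 * R j) * (if ∀ j, |x j - round (x j)| < 1 / (2 * R j) then 1 else 0) := by
  have hR0 : ∀ j, 0 < R j := fun j => by linarith [hR j]
  split_ifs with h
  · rw [mul_one]
    exact Finset.prod_le_prod (fun j _ => fejerSum_nonneg _ _ (hR0 j).le) fun j _ => fejerSum_le (hR0 j) _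
  · rw [mul_zero]
    push Not at h
    obtain ⟨j, hj⟩ := h
    rw [Finset.prod_eq_zero (Finset.mem_univ j) (by unfold Fk; exact fejerSum_eq_zero (hR0 j) hj)]

/-- **The Fejér insertion** (Ford's smoothing step (5.4)): for weights `|ε_b| ≤ 1`, frequencies
`θ_b ∈ ℝ^k`, and a finite set `C₀` of integer vectors with `1 ≤ c_j ≤ R_j`,
`∑_{c ∈ C₀} |∑_b ε_b e(c·θ_b)|^{2s} ≤ (∏_j 5R_j) #{(β,β') ∈ B^s × B^s : ‖(∑_i θ_{β_i} - ∑_i θ_{β'_i})_j‖ < 1/(2R_j) ∀ j}`.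
[cite: Ford2002, proof of Lemma 5.1, (5.4)–(5.5)] -/
theorem fejer_insertion {s : ℕ} (B : Finset ι) (ε : ι → ℂ) (hε : ∀ b ∈ B, ‖ε b‖ ≤ 1)
    (θ : ι → Fin k → ℝ) (R : Fin k → ℝ) (hR : ∀ j, 1 ≤ R j) (C₀ : Finset (Fin k → ℤ))
    (hC₀ : ∀ c ∈ C₀, ∀ j, 1 ≤ c j ∧ (c j : ℝ) ≤ R j) :
    ∑ c ∈ C₀, ‖∑ b ∈ B, ε b * E c (θ b)‖ ^ (2 * s)
      ≤ (∏ j, 5 * R j) * (((Fintype.piFinset (fun _ : Fin s => B) ×ˢ Fintype.piFinset (fun _ : Fin s => B)).filter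
          fun ββ' => ∀ j, |(∑ i, θ (ββ'.1 i) - ∑ i, θ (ββ'.2 i)) j
            - round ((∑ i, θ (ββ'.1 i) - ∑ i, θ (ββ'.2 i)) j)| < 1 / (2 * R j)).card) := by
  classical
  set T2 := Fintype.piFinset (fun _ : Fin s => B) ×ˢ Fintype.piFinset (fun _ : Fin s => B) with hT2
  set X : (Fin k → ℤ) → ℂ := fun c => ∑ b ∈ B, ε b * E c (θ b) with hX
  set G : (Fin k → ℤ) → ℝ := fun c => ‖X c‖ ^ (2 * s) with hG
  set coef : ((Fin s → ι) × (Fin s → ι)) → ℂ := fun ββ' => (∏ i, ε (ββ'.1 i)) * conj (∏ i, ε (ββ'.2 i))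
    with hcoef
  set Δ : ((Fin s → ι) × (Fin s → ι)) → Fin k → ℝ := fun ββ' => ∑ i, θ (ββ'.1 i) - ∑ i, θ (ββ'.2 i)
    with hΔ
  have hG0 : ∀ c, 0 ≤ G c := fun c => by positivity
  -- Step 1: insert the weights
  have step1 : ∑ c ∈ C₀, G c ≤ ∑ c ∈ C₀, Wt R c * G c :=
    Finset.sum_le_sum fun c hc => le_mul_of_one_le_left (hG0 c) (one_le_Wt R (hC₀ c hc))
  -- Step 2: enlarge to a box
  set Box : ℕ → Finset (Fin k → ℤ) := fun L => Fintype.piFinset (fun _ : Fin k => Finset.Icc (-(L : ℤ)) (L : ℤ))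
    with hBox
  obtain ⟨L₀, hL₀⟩ : ∃ L₀ : ℕ, ∀ j, R j ≤ L₀ := by
    refine ⟨⌈∑ j, R j⌉₊, fun j => ?_⟩
    have h0 : ∀ i, 0 ≤ R i := fun i => by linarith [hR i]
    exact (Finset.single_le_sum (fun i _ => h0 i) (Finset.mem_univ j)).trans (Nat.le_ceil _)
  have hsub : ∀ L, L₀ ≤ L → C₀ ⊆ Box L := by
    intro L hL c hc
    rw [hBox, Fintype.mem_piFinset]
    intro j
    have h1 := hC₀ c hc j
    have h2 : (c j : ℝ) ≤ L := (h1.2.trans (hL₀ j)).trans (by exact_mod_cast hL)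
    rw [Finset.mem_Icc]
    constructor
    · linarith [h1.1]
    · exact_mod_cast h2
  have step2 : ∀ L, L₀ ≤ L → ∑ c ∈ C₀, Wt R c * G c ≤ ∑ c ∈ Box L, Wt R c * G c := fun L hL =>
    Finset.sum_le_sum_of_subset_of_nonneg (hsub L hL) fun c _ _ => mul_nonneg (Wt_nonneg R c) (hG0 c)
  -- Step 3: the box identity
  have step3 : ∀ L, ((∑ c ∈ Box L, Wt R c * G c : ℝ) : ℂ)
      = ∑ ββ' ∈ T2, coef ββ' * ∏ j, ∑ cj ∈ Finset.Icc (-(L : ℤ)) (L : ℤ),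
          (fejerWeight (R j) cj : ℂ) * e (cj * Δ ββ' j) := by
    intro L
    push_cast
    have h1 : ∀ c, ((G c : ℝ) : ℂ) = ∑ ββ' ∈ T2, coef ββ' * E c (Δ ββ') := fun c => by
      rw [hG, hX, hT2, hcoef, hΔ]; exact norm_sum_mul_E_pow B ε θ c s
    simp_rw [h1, Finset.mul_sum]
    rw [Finset.sum_comm]
    refine Finset.sum_congr rfl fun ββ' _ => ?_
    simp_rw [show ∀ c, (Wt R c : ℂ) * (coef ββ' * E c (Δ ββ')) = coef ββ' * ((Wt R c : ℂ) * E c (Δ ββ'))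
      from fun c => by ring]
    rw [← Finset.mul_sum, hBox, sum_box_Wt_mul_E]
  -- Step 4: the limit `L → ∞`
  have step4 : Tendsto (fun L : ℕ => ∑ ββ' ∈ T2, coef ββ' * ∏ j, ∑ cj ∈ Finset.Icc (-(L : ℤ)) (L : ℤ),
          (fejerWeight (R j) cj : ℂ) * e (cj * Δ ββ' j)) atTop
      (𝓝 (∑ ββ' ∈ T2, coef ββ' * ∏ j, ((Fk R j (Δ ββ' j) : ℝ) : ℂ))) := by
    refine tendsto_finsetSum _ fun ββ' _ => Tendsto.const_mul _ ?_
    exact tendsto_finsetProd _ fun j _ => tendsto_partial_fejer (hR j) _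
  -- Step 5: pass to the limit
  have step5 : ∑ c ∈ C₀, G c ≤ (∑ ββ' ∈ T2, coef ββ' * ∏ j, ((Fk R j (Δ ββ' j) : ℝ) : ℂ)).re := by
    refine ge_of_tendsto (Complex.continuous_re.continuousAt.tendsto.comp step4) ?_
    rw [Filter.eventually_atTop]
    refine ⟨L₀, fun L hL => ?_⟩
    simp only [Function.comp]
    rw [← step3 L, Complex.ofReal_re]
    exact step1.trans (step2 L hL)
  -- Step 6: bound the limit
  have hcoef : ∀ ββ' ∈ T2, ‖coef ββ'‖ ≤ 1 := by
    intro ββ' hββ'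
    rw [hT2, Finset.mem_product, Fintype.mem_piFinset, Fintype.mem_piFinset] at hββ'
    rw [hcoef]
    simp only
    rw [norm_mul, norm_conj, norm_prod, norm_prod]
    have h1 : ∏ i, ‖ε (ββ'.1 i)‖ ≤ 1 := by
      calc ∏ i, ‖ε (ββ'.1 i)‖ ≤ ∏ _i : Fin s, (1 : ℝ) :=
            Finset.prod_le_prod (fun i _ => norm_nonneg _) fun i _ => hε _ (hββ'.1 i)
        _ = 1 := by simp
    have h2 : ∏ i, ‖ε (ββ'.2 i)‖ ≤ 1 := by
      calc ∏ i, ‖ε (ββ'.2 i)‖ ≤ ∏ _i : Fin s, (1 : ℝ) :=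
            Finset.prod_le_prod (fun i _ => norm_nonneg _) fun i _ => hε _ (hββ'.2 i)
        _ = 1 := by simp
    have h3 : 0 ≤ ∏ i, ‖ε (ββ'.2 i)‖ := Finset.prod_nonneg fun i _ => norm_nonneg _
    nlinarith
  have hF0 : ∀ ββ', 0 ≤ ∏ j, Fk R j (Δ ββ' j) := fun ββ' =>
    Finset.prod_nonneg fun j _ => fejerSum_nonneg _ _ (by linarith [hR j])
  have step6 : (∑ ββ' ∈ T2, coef ββ' * ∏ j, ((Fk R j (Δ ββ' j) : ℝ) : ℂ)).re
      ≤ ∑ ββ' ∈ T2, ∏ j, Fk R j (Δ ββ' j) := by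
    refine (Complex.re_le_norm _).trans ((norm_sum_le _ _).trans (Finset.sum_le_sum fun ββ' hββ' => ?_))
    rw [norm_mul, ← Complex.ofReal_prod, Complex.norm_real, Real.norm_eq_abs, abs_of_nonneg (hF0 ββ')]
    exact (mul_le_mul_of_nonneg_right (hcoef ββ' hββ') (hF0 ββ')).trans (le_of_eq (one_mul _))
  -- Step 7: the indicator
  have step7 : ∑ ββ' ∈ T2, ∏ j, Fk R j (Δ ββ' j)
      ≤ (∏ j, 5 * R j) * ((T2.filter fun ββ' => ∀ j, |Δ ββ' j - round (Δ ββ' j)| < 1 / (2 * R j)).card : ℝ) := by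
    calc ∑ ββ' ∈ T2, ∏ j, Fk R j (Δ ββ' j)
        ≤ ∑ ββ' ∈ T2, (∏ j, 5 * R j) * (if ∀ j, |Δ ββ' j - round (Δ ββ' j)| < 1 / (2 * R j) then 1 else 0) :=
          Finset.sum_le_sum fun ββ' _ => prod_Fk_le R hR (Δ ββ')
      _ = (∏ j, 5 * R j) * ((T2.filter fun ββ' => ∀ j, |Δ ββ' j - round (Δ ββ' j)| < 1 / (2 * R j)).card : ℝ) := by
          rw [← Finset.mul_sum, Finset.sum_boole]
  exact step5.trans (step6.trans step7)

end Fejer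


/-! ### The bilinear bound: `|U|^{2rs} ≤ |ℬ|^{2rs-2s} M^{2rs-2r} J_{r,k}(M) · T` and `T` via (E3) -/

section Ubound

variable {k : ℕ}

/-- The frequencies `θ_b = (γ_j b^j)_j` of `V_b = ∑_{a ≤ M} e(γ₁ab + ⋯ + γ_k (ab)^k)`.
[cite: Ford2002, proof of Lemma 5.1] -/
def thetaB (γ : Fin k → ℝ) (b : ℤ) : Fin k → ℝ := fun j => γ j * (b : ℝ) ^ (j.val + 1)

/-- Differences of the summed frequencies are `γ_j d_j` with `d = s(β) - s(β')`. [cite: Ford2002,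
proof of Lemma 5.1 (the `d_j`)] -/
theorem sum_thetaB_sub {s : ℕ} (γ : Fin k → ℝ) (β β' : Fin s → ℤ) (j : Fin k) :
    (∑ i, thetaB γ (β i) - ∑ i, thetaB γ (β' i)) j = γ j * ((psv k β - psv k β') j : ℤ) := by
  simp only [Pi.sub_apply, Finset.sum_apply, thetaB, psv]
  push_cast
  rw [mul_sub, Finset.mul_sum, Finset.mul_sum]

/-- A unimodular multiplier turning `z` into `|z|`. [folklore] -/
def unitOf (z : ℂ) : ℂ := if z = 0 then 1 else conj z / (‖z‖ : ℂ)

/-- `|unitOf z| ≤ 1`. [folklore] -/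
theorem norm_unitOf_le (z : ℂ) : ‖unitOf z‖ ≤ 1 := by
  unfold unitOf
  split_ifs with h
  · simp
  · rw [norm_div, norm_conj, Complex.norm_real, Real.norm_eq_abs, abs_of_nonneg (norm_nonneg _),
      div_self (norm_ne_zero_iff.2 h)]

/-- `unitOf z · z = |z|`. [folklore] -/
theorem unitOf_mul (z : ℂ) : unitOf z * z = (‖z‖ : ℂ) := by
  unfold unitOf
  split_ifs with h
  · simp [h]
  · have hz : (‖z‖ : ℂ) ≠ 0 := by exact_mod_cast norm_ne_zero_iff.2 h
    rw [div_mul_eq_mul_div, div_eq_iff hz, mul_comm (conj z), Complex.mul_conj']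
    ring

/-- **Ford (5.3) with the smoothing (5.4)–(5.5).** Let `r, s ≥ 1`, `I = [1, M]` (`M ≥ 1`),
`ℬ ⊆ [1, P₂]` a finite set of integers, `γ ∈ ℝ^k`, and `U = ∑_{b ∈ ℬ} ∑_{a ≤ M} e(∑_j γ_j (ab)^j)`.
Then for `1 ≤ h ≤ g ≤ k`,
`|U|^{2rs} ≤ |ℬ|^{2rs-2s} (M^r)^{2s-2} J_{r,k}(M) · (∏_j 5rM^j) · (∏_{j=h}^{g} |𝒟_j|) · J_{s,k,[h,g]}(ℬ)`,
where `𝒟_j = {|d| ≤ sP₂^j - s : ‖γ_j d‖ < 1/(2rM^j)}`.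
[cite: Ford2002, proof of Lemma 5.1, (5.3)–(5.5)] -/
theorem norm_U_pow_le {r s M P₂ h g : ℕ} (hr : 1 ≤ r) (hs : 1 ≤ s) (hM : 1 ≤ M)
    (B : Finset ℤ) (hB : ∀ b ∈ B, 1 ≤ b ∧ b ≤ P₂) (γ : Fin k → ℝ) :
    ‖∑ b ∈ B, tp (Finset.Icc (1 : ℤ) M) (nu k) (thetaB γ b)‖ ^ (2 * r * s)
      ≤ (B.card : ℝ) ^ (2 * r * s - 2 * s) * ((M : ℝ) ^ r) ^ (2 * s - 2)
        * (J k r (Finset.Icc (1 : ℤ) M) : ℝ)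
        * ((∏ j : Fin k, (5 * (r * (M : ℝ) ^ (j.val + 1))))
          * (∏ j : Fin k, if h ≤ j.val + 1 ∧ j.val + 1 ≤ g then
              (((Finset.Icc (-((s * P₂ ^ (j.val + 1) - s : ℕ) : ℤ)) ((s * P₂ ^ (j.val + 1) - s : ℕ) : ℤ)).filter
                fun d : ℤ => |γ j * (d : ℝ) - round (γ j * (d : ℝ))| < 1 / (2 * (r * (M : ℝ) ^ (j.val + 1)))).card : ℝ)
              else 1)
          * (Jinc k s B h g : ℝ)) := by
  classical
  set I := Finset.Icc (1 : ℤ) M with hI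
  set V : ℤ → ℂ := fun b => tp I (nu k) (thetaB γ b) with hV
  set C₀ := (tuples r I).image (psv k) with hC₀
  set n : (Fin k → ℤ) → ℕ := fun c => rep k r I c with hn
  set ε : ℤ → ℂ := fun b => unitOf (V b ^ r) with hε
  set X : (Fin k → ℤ) → ℂ := fun c => ∑ b ∈ B, ε b * E c (thetaB γ b) with hX
  set Y : (Fin k → ℤ) → ℝ := fun c => ‖X c‖ with hY
  have hIcard : I.card = M := by rw [hI, Int.card_Icc]; simp
  -- (1) `|U|^r ≤ |B|^{r-1} ∑_b |V_b|^r`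
  obtain ⟨r', hr'⟩ : ∃ r', r = r' + 1 := ⟨r - 1, by omega⟩
  have h1 : ‖∑ b ∈ B, V b‖ ^ r ≤ (B.card : ℝ) ^ r' * ∑ b ∈ B, ‖V b‖ ^ r := by
    calc ‖∑ b ∈ B, V b‖ ^ r ≤ (∑ b ∈ B, ‖V b‖) ^ r := pow_le_pow_left₀ (norm_nonneg _) (norm_sum_le _ _) _
      _ ≤ (B.card : ℝ) ^ r' * ∑ b ∈ B, ‖V b‖ ^ r := by
          rw [hr']; exact pow_sum_le_card_mul_sum_pow (fun b _ => norm_nonneg (V b)) r'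
  -- (2) `∑_b |V_b|^r ≤ ∑_c n(c) |X_c|`
  have h2 : ∑ b ∈ B, ‖V b‖ ^ r ≤ ∑ c ∈ C₀, (n c : ℝ) * Y c := by
    have e1 : ∀ b, ((‖V b‖ ^ r : ℝ) : ℂ) = ε b * ∑ c ∈ C₀, (n c : ℂ) * E c (thetaB γ b) := by
      intro b
      simp only [hε, hC₀, hn, hV]
      rw [← tp_pow_eq_sum_rep, ← norm_pow, unitOf_mul]
    have e2 : ((∑ b ∈ B, ‖V b‖ ^ r : ℝ) : ℂ) = ∑ c ∈ C₀, (n c : ℂ) * X c := by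
      rw [Complex.ofReal_sum]
      simp_rw [e1, Finset.mul_sum, hX, Finset.mul_sum]
      rw [Finset.sum_comm]
      refine Finset.sum_congr rfl fun c _ => Finset.sum_congr rfl fun b _ => ?_
      ring
    have e3 : ∑ b ∈ B, ‖V b‖ ^ r = ‖∑ c ∈ C₀, (n c : ℂ) * X c‖ := by
      rw [← e2, Complex.norm_real, Real.norm_eq_abs, abs_of_nonneg]
      exact Finset.sum_nonneg fun b _ => by positivity
    rw [e3]
    refine (norm_sum_le _ _).trans (le_of_eq (Finset.sum_congr rfl fun c _ => ?_))
    rw [norm_mul, Complex.norm_natCast]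
  -- (3) `(∑ n Y)^{2s} ≤ (∑ n)^{2s-2} (∑ n²) (∑ Y^{2s})`
  obtain ⟨s', hs'⟩ : ∃ s', s = s' + 1 := ⟨s - 1, by omega⟩
  have hY0 : ∀ c, 0 ≤ Y c := fun c => norm_nonneg _
  have hregroup : ∀ (F : (Fin k → ℤ) → ℝ), ∑ a ∈ tuples r I, F (psv k a) = ∑ c ∈ C₀, (n c : ℝ) * F c := by
    intro F
    rw [Finset.sum_comp (s := tuples r I) (f := F) (g := psv k)]
    refine Finset.sum_congr rfl fun c _ => ?_
    rw [nsmul_eq_mul]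
    rfl
  have hsumn : ∑ c ∈ C₀, (n c : ℝ) = (M : ℝ) ^ r := by
    have := sum_rep_eq k r I
    rw [hIcard] at this
    exact_mod_cast this
  have hsumn2 : ∑ c ∈ C₀, (n c : ℝ) ^ 2 = (J k r I : ℝ) := by exact_mod_cast sum_rep_sq_eq k r I
  have h3 : (∑ c ∈ C₀, (n c : ℝ) * Y c) ^ (2 * s)
      ≤ ((M : ℝ) ^ r) ^ (2 * s - 2) * (J k r I : ℝ) * ∑ c ∈ C₀, Y c ^ (2 * s) := by
    have hcardT : ((tuples r I).card : ℝ) = (M : ℝ) ^ r := by rw [card_tuples, hIcard]; push_cast; ring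
    -- power mean over tuples
    have hpm : (∑ c ∈ C₀, (n c : ℝ) * Y c) ^ s ≤ ((M : ℝ) ^ r) ^ s' * ∑ c ∈ C₀, (n c : ℝ) * Y c ^ s := by
      rw [← hregroup Y, ← hregroup (fun c => Y c ^ s), ← hcardT, hs']
      exact pow_sum_le_card_mul_sum_pow (fun a _ => hY0 _) s'
    -- Cauchy–Schwarz
    have hcs : (∑ c ∈ C₀, (n c : ℝ) * Y c ^ s) ^ 2 ≤ (J k r I : ℝ) * ∑ c ∈ C₀, Y c ^ (2 * s) := by
      rw [← hsumn2]
      have := Finset.sum_mul_sq_le_sq_mul_sq C₀ (fun c => (n c : ℝ)) (fun c => Y c ^ s)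
      simp only [← pow_mul, show s * 2 = 2 * s by ring] at this
      exact this
    have h0 : 0 ≤ ∑ c ∈ C₀, (n c : ℝ) * Y c := Finset.sum_nonneg fun c _ => by positivity
    calc (∑ c ∈ C₀, (n c : ℝ) * Y c) ^ (2 * s) = ((∑ c ∈ C₀, (n c : ℝ) * Y c) ^ s) ^ 2 := by
          rw [← pow_mul, mul_comm]
      _ ≤ (((M : ℝ) ^ r) ^ s' * ∑ c ∈ C₀, (n c : ℝ) * Y c ^ s) ^ 2 :=
          pow_le_pow_left₀ (pow_nonneg h0 _) hpm 2
      _ = (((M : ℝ) ^ r) ^ s') ^ 2 * (∑ c ∈ C₀, (n c : ℝ) * Y c ^ s) ^ 2 := by ring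
      _ ≤ (((M : ℝ) ^ r) ^ s') ^ 2 * ((J k r I : ℝ) * ∑ c ∈ C₀, Y c ^ (2 * s)) :=
          mul_le_mul_of_nonneg_left hcs (by positivity)
      _ = ((M : ℝ) ^ r) ^ (2 * s - 2) * (J k r I : ℝ) * ∑ c ∈ C₀, Y c ^ (2 * s) := by
          rw [← pow_mul, show s' * 2 = 2 * s - 2 by omega]; ring
  -- (4) Fejér insertion on `C₀`
  set R : Fin k → ℝ := fun j => r * (M : ℝ) ^ (j.val + 1) with hR
  have hR1 : ∀ j, 1 ≤ R j := fun j => by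
    rw [hR]; simp only
    have h1 : (1 : ℝ) ≤ r := by exact_mod_cast hr
    have h2 : (1 : ℝ) ≤ (M : ℝ) ^ (j.val + 1) := one_le_pow₀ (by exact_mod_cast hM)
    nlinarith
  have hC₀ : ∀ c ∈ C₀, ∀ j, 1 ≤ c j ∧ (c j : ℝ) ≤ R j := by
    intro c hc j
    rw [hC₀, Finset.mem_image] at hc
    obtain ⟨a, ha, rfl⟩ := hc
    rw [mem_tuples] at ha
    have hai : ∀ i, 1 ≤ a i ∧ a i ≤ M := fun i => by
      have := ha i; rw [hI, Finset.mem_Icc] at this; exact this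
    simp only [psv]
    constructor
    · calc (1 : ℤ) ≤ r := by exact_mod_cast hr
        _ = ∑ _i : Fin r, (1 : ℤ) := by simp
        _ ≤ ∑ i, a i ^ (j.val + 1) := Finset.sum_le_sum fun i _ => one_le_pow₀ (hai i).1
    · rw [hR]; simp only
      push_cast
      calc ∑ i, (a i : ℝ) ^ (j.val + 1) ≤ ∑ _i : Fin r, (M : ℝ) ^ (j.val + 1) := by
            refine Finset.sum_le_sum fun i _ => pow_le_pow_left₀ ?_ ?_ _
            · exact Int.cast_nonneg (by have := (hai i).1; omega)
            · exact_mod_cast (hai i).2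
        _ = r * (M : ℝ) ^ (j.val + 1) := by simp
  have hεB : ∀ b ∈ B, ‖ε b‖ ≤ 1 := fun b _ => norm_unitOf_le _
  have h4 := fejer_insertion (s := s) B ε hεB (thetaB γ) R hR1 C₀ hC₀
  -- (5) from `‖γ_j d_j‖ < 1/(2R_j)` for all `j` to the box count
  have h5 : (((tuples s B ×ˢ tuples s B).filter fun ββ' => ∀ j,
        |(∑ i, thetaB γ (ββ'.1 i) - ∑ i, thetaB γ (ββ'.2 i)) j
          - round ((∑ i, thetaB γ (ββ'.1 i) - ∑ i, thetaB γ (ββ'.2 i)) j)| < 1 / (2 * R j)).card : ℝ)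
      ≤ (∏ j : Fin k, if h ≤ j.val + 1 ∧ j.val + 1 ≤ g then
            (((Finset.Icc (-((s * P₂ ^ (j.val + 1) - s : ℕ) : ℤ)) ((s * P₂ ^ (j.val + 1) - s : ℕ) : ℤ)).filter
              fun d : ℤ => |γ j * (d : ℝ) - round (γ j * (d : ℝ))| < 1 / (2 * (r * (M : ℝ) ^ (j.val + 1)))).card : ℝ)
            else 1) * (Jinc k s B h g : ℝ) := by
    set D : Fin k → Finset ℤ := fun j =>
      (Finset.Icc (-((s * P₂ ^ (j.val + 1) - s : ℕ) : ℤ)) ((s * P₂ ^ (j.val + 1) - s : ℕ) : ℤ)).filter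
        fun d : ℤ => |γ j * (d : ℝ) - round (γ j * (d : ℝ))| < 1 / (2 * (r * (M : ℝ) ^ (j.val + 1))) with hD
    have hsub : ((tuples s B ×ˢ tuples s B).filter fun ββ' => ∀ j,
        |(∑ i, thetaB γ (ββ'.1 i) - ∑ i, thetaB γ (ββ'.2 i)) j
          - round ((∑ i, thetaB γ (ββ'.1 i) - ∑ i, thetaB γ (ββ'.2 i)) j)| < 1 / (2 * R j))
        ⊆ ((tuples s B ×ˢ tuples s B).filter fun ββ' => ∀ j : Fin k, h ≤ j.val + 1 → j.val + 1 ≤ g →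
            psv k ββ'.1 j - psv k ββ'.2 j ∈ D j) := by
      intro ββ' hββ'
      rw [Finset.mem_filter] at hββ' ⊢
      refine ⟨hββ'.1, fun j _ _ => ?_⟩
      have hj := hββ'.2 j
      rw [sum_thetaB_sub] at hj
      rw [hD, Finset.mem_filter, Finset.mem_Icc]
      refine ⟨?_, ?_⟩
      · -- `|d_j| ≤ s P₂^{j+1}`
        rw [Finset.mem_product, mem_tuples, mem_tuples] at hββ'
        have hb1 : ∀ i, 1 ≤ ββ'.1 i ∧ ββ'.1 i ≤ P₂ := fun i => hB _ (hββ'.1.1 i)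
        have hb2 : ∀ i, 1 ≤ ββ'.2 i ∧ ββ'.2 i ≤ P₂ := fun i => hB _ (hββ'.1.2 i)
        have hup : ∀ (β : Fin s → ℤ), (∀ i, 1 ≤ β i ∧ β i ≤ P₂) →
            (s : ℤ) ≤ psv k β j ∧ psv k β j ≤ s * (P₂ : ℤ) ^ (j.val + 1) := by
          intro β hβ
          simp only [psv]
          constructor
          · calc (s : ℤ) = ∑ _i : Fin s, (1 : ℤ) := by simp
              _ ≤ ∑ i, β i ^ (j.val + 1) := Finset.sum_le_sum fun i _ => one_le_pow₀ (hβ i).1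
          · calc ∑ i, β i ^ (j.val + 1) ≤ ∑ _i : Fin s, (P₂ : ℤ) ^ (j.val + 1) :=
                  Finset.sum_le_sum fun i _ => pow_le_pow_left₀ (by linarith [(hβ i).1]) (hβ i).2 _
              _ = s * (P₂ : ℤ) ^ (j.val + 1) := by simp
        have e1 := hup _ hb1
        have e2 := hup _ hb2
        have hP₂ : 1 ≤ P₂ := by
          have := hb1 ⟨0, by omega⟩
          exact_mod_cast this.1.trans this.2
        have hKcast : (((s * P₂ ^ (j.val + 1) - s : ℕ) : ℤ)) = s * (P₂ : ℤ) ^ (j.val + 1) - s := by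
          have hle : s ≤ s * P₂ ^ (j.val + 1) := Nat.le_mul_of_pos_right s (pow_pos hP₂ _)
          push_cast [Nat.cast_sub hle]
          ring
        rw [hKcast]
        constructor <;> linarith [e1.1, e1.2, e2.1, e2.2]
      · simp only [hR] at hj
        push_cast at hj ⊢
        simpa [Pi.sub_apply] using hj
    calc _ ≤ ((((tuples s B ×ˢ tuples s B).filter fun ββ' => ∀ j : Fin k, h ≤ j.val + 1 → j.val + 1 ≤ g →
            psv k ββ'.1 j - psv k ββ'.2 j ∈ D j).card : ℕ) : ℝ) := by exact_mod_cast Finset.card_le_card hsub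
      _ ≤ (((∏ j : Fin k, if h ≤ j.val + 1 ∧ j.val + 1 ≤ g then (D j).card else 1) * Jinc k s B h g : ℕ) : ℝ) := by
          exact_mod_cast card_filter_mem_le_Jinc_mul_prod k s B h g D
      _ = _ := by
          push_cast
          congr 1
  -- (6) assemble
  have hB0 : (0 : ℝ) ≤ B.card := Nat.cast_nonneg _
  calc ‖∑ b ∈ B, V b‖ ^ (2 * r * s) = (‖∑ b ∈ B, V b‖ ^ r) ^ (2 * s) := by rw [← pow_mul]; ring_nf
    _ ≤ ((B.card : ℝ) ^ r' * ∑ b ∈ B, ‖V b‖ ^ r) ^ (2 * s) := pow_le_pow_left₀ (by positivity) h1 _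
    _ ≤ ((B.card : ℝ) ^ r' * ∑ c ∈ C₀, (n c : ℝ) * Y c) ^ (2 * s) := by
        refine pow_le_pow_left₀ (by positivity) (mul_le_mul_of_nonneg_left h2 (by positivity)) _
    _ = (B.card : ℝ) ^ (2 * r * s - 2 * s) * (∑ c ∈ C₀, (n c : ℝ) * Y c) ^ (2 * s) := by
        rw [mul_pow, ← pow_mul]; congr 2; rw [hr']; ring_nf; omega
    _ ≤ (B.card : ℝ) ^ (2 * r * s - 2 * s) * (((M : ℝ) ^ r) ^ (2 * s - 2) * (J k r I : ℝ) * ∑ c ∈ C₀, Y c ^ (2 * s)) :=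
        mul_le_mul_of_nonneg_left h3 (by positivity)
    _ ≤ (B.card : ℝ) ^ (2 * r * s - 2 * s) * (((M : ℝ) ^ r) ^ (2 * s - 2) * (J k r I : ℝ)
          * ((∏ j, 5 * R j) * ((∏ j : Fin k, if h ≤ j.val + 1 ∧ j.val + 1 ≤ g then
              (((Finset.Icc (-((s * P₂ ^ (j.val + 1) - s : ℕ) : ℤ)) ((s * P₂ ^ (j.val + 1) - s : ℕ) : ℤ)).filter
                fun d : ℤ => |γ j * (d : ℝ) - round (γ j * (d : ℝ))| < 1 / (2 * (r * (M : ℝ) ^ (j.val + 1)))).card : ℝ)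
              else 1) * (Jinc k s B h g : ℝ)))) := by
        refine mul_le_mul_of_nonneg_left (mul_le_mul_of_nonneg_left ?_ (by positivity)) (by positivity)
        refine h4.trans (mul_le_mul_of_nonneg_left h5 ?_)
        exact Finset.prod_nonneg fun j _ => by have := hR1 j; positivity
    _ = _ := by rw [hR]; ring

end Ubound

end FordVK
end Literature.NumberTheory.LFunctions
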